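import Summits.BirchSwinnertonDyer.BirchSwinnertonDyer.Theorems.EisensteinPrimesBSDpOnCellCTelescopeK2PurityTolerantOfCore
import Summits.BirchSwinnertonDyer.BirchSwinnertonDyer.Theorems.PrintCf2SplitBadTwoNoPseudoNullOfLine
import Mathlib.RingTheory.Filtration
import Mathlib.RingTheory.Artinian.Module
import Mathlib.RingTheory.QuotSMulTop
import HarnessLib

/-!
# Crux 4 `BSDpOnCellC` (stmt-BirchSwinnertonDyer-19034), line «telescope», sub-leaf W4 of leaf N2, node W4⁰
# (`K2Weight2.stub_bigPseudoNullPTorsion`) — route G′, part 2: the almost-divisible cores `p^a · L(K_w, 𝐃)` at the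
# places `w ∣ N` (pure algebra over `B = ℤ_p⟦X⟧⟦T⟧`; ideator bsd-idea-12 g39; `--supports`, helper; closes nothing)

Context: part 1 (`…TelescopeK2PurityTolerantOfCore`) turns an almost-divisible core `S_{𝓛'}`, `p^a S_𝓛 ≤ S_{𝓛'} ≤ S_𝓛`,
into W4⁰-type `p`-power tolerance of the pseudo-null submodules of every dual of `S_𝓛`, and reads almost
divisibility of `p^a · N` on `p^a · N̂`. This file certifies the local cores at `w ∣ N`:

* §1 **eventually no finite submodule in `c^a V`** (`exists_forall_finite_le_range_lsmul_pow_eq_bot`): for a finitely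
  generated module `V` over a Noetherian local ring and `c ∈ 𝔪`, some `c^a V` contains no non-zero finite
  submodule (maximal finite submodule `F` — it exists, `exists_maximal_finite_submodule` —, Artinian
  stabilisation of `F ∩ c^a V`, Krull's intersection theorem `Ideal.iInf_pow_smul_eq_bot_of_isLocalRing`);
* §2 **`(rY) ∩ tY = t(rY)`** when `t` is a non-zero-divisor on `Y/rY` (`quotSMulTop_map_subtype_injective`): the map
  `rY/t(rY) → Y/tY` is injective with image in `r(Y/tY)`, so "no finite submodule inside `r(Y/tY)`" transfers to
  "no finite submodule of `rY/t(rY)`" (`forall_finite_submodule_quotSMulTop_range_lsmul_eq_bot`);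
* §3 **the `w ∣ N` package** over `B = ℤ_p⟦X⟧⟦T⟧` (`exists_hasNoPseudoNullSubmodule_range_lsmul_pow`,
  `exists_isAlmostDivisible_map_lsmul_pow`, and the discrete-side forms `…_characterModule`,
  `exists_isAlmostDivisible_map_lsmul_pow_of_surjective`): for a finitely generated `B`-module `Y` with `T` a
  non-zero-divisor on `Y` and on every `Y/p^aY` (read: `Y = (𝐃^{I_w})^∨`; both follow from `T`-DIVISIBILITY of the
  big representation and of its `p^a`-torsion, part 1 §3), SOME `p^a Y` has no non-zero pseudo-null submodule —
  §1 on `Y/TY`, §2, and S3n ⟸ (REG) ∧ (NF) `PrintCf2.NoPseudoNullOfLine.noPseudoNull_of_X_regular_of_noFiniteSubmodule`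
  (the `Ass` of a flat base change, Matsumura Thm. 23.2 (ii)); hence for a local condition `N ≤ H¹(K_w, 𝐃)` that is a
  `B`-quotient of such an `M = 𝐃^{I_w}` (via `𝐃^{I_w} ↠ 𝐃^{I_w}/(Frob_w − 1) ≅ H¹_ur = L(K_w, 𝐃)`), SOME `p^a • N` is an
  almost divisible `B`-module: the core local condition `𝓛'_w` of route G′, `p^a 𝓛_w ≤ 𝓛'_w ≤ 𝓛_w`.

HONESTY. Pure algebra; nothing here proves W4⁰, W4, N2, the crux `BSDpOnCellC` or any summit statement; the model
facts at `w ∣ N` (cofinite generation of `𝐃^{I_w}`, the two `T`-divisibilities, the quotient map onto `L(K_w, 𝐃)`) and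
the hypotheses of Greenberg's Prop. 4.1.1 (c) for the core specification are displayed, not claimed. BSD is proved
for no curve. AI-typed, kernel-checked; theorems only (no `def`, no instance, no named fact, no `sorry`).

[cite: Greenberg2016Selmer, §2.5 p. 8 L35–37, Remark 3.1.2, §4.2 p. 19 L25–31] [cite: Greenberg2006, Prop. 2.4 (pp. 350–351)]
[cite: BourbakiAC5to7, Ch. VII §4 no. 4] [cite: Matsumura1987, Thm. 8.10 (Krull, p. 73), Thm. 23.2 (ii) (p. 196)]
-/

set_option autoImplicit false
-- every decl lives in the file's own namespace; the linter fires on the path-vs-namespace mismatch only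
set_option linter.dupNamespace false

open scoped Classical
open Literature.NumberTheory.IwasawaTheory.Greenberg2016
open Literature.NumberTheory.EllipticCurves (Module.IsPseudoNull IwasawaAlgebra₂)
open Summit.BirchSwinnertonDyer.BirchSwinnertonDyer.Theorems.TelescopeK2PurityTolerantOfCore

namespace Summit.BirchSwinnertonDyer.BirchSwinnertonDyer.Theorems.TelescopeK2PurityCoreAtBadPrimes

/-! ## §1 Eventually no non-zero finite submodule in `c^a V` -/

section MaxFinite

variable {Λ : Type*} [CommRing Λ] {V : Type*} [AddCommGroup V] [Module Λ V]

/-- The sum of two finite submodules is finite. [folklore] -/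
theorem finite_sup_of_finite (F Q : Submodule Λ V) [Finite F] [Finite Q] : Finite ↥(F ⊔ Q) := by
  refine Finite.of_surjective
    (fun fq : F × Q ↦ (⟨(fq.1 : V) + fq.2, Submodule.add_mem_sup fq.1.2 fq.2.2⟩ : ↥(F ⊔ Q))) ?_
  rintro ⟨x, hx⟩
  obtain ⟨f, hf, q, hq, rfl⟩ := Submodule.mem_sup.mp hx
  exact ⟨(⟨f, hf⟩, ⟨q, hq⟩), rfl⟩

/-- **A Noetherian module has a largest finite submodule** (a maximal element of the set of finite submodules
absorbs every finite submodule, the sum of two finite submodules being finite). [folklore]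
[cite: BourbakiAC5to7, Ch. VII §4 no. 4 (shape: the largest pseudo-null submodule)] -/
theorem exists_maximal_finite_submodule [IsNoetherian Λ V] :
    ∃ F : Submodule Λ V, Finite F ∧ ∀ Q : Submodule Λ V, Finite Q → Q ≤ F := by
  obtain ⟨F, hF, hmax⟩ := set_has_maximal_iff_noetherian.mpr (inferInstance : IsNoetherian Λ V)
    {Q : Submodule Λ V | Finite Q} ⟨⊥, show Finite (⊥ : Submodule Λ V) from inferInstance⟩
  refine ⟨F, hF, fun Q hQ ↦ ?_⟩
  haveI : Finite F := hF
  haveI : Finite Q := hQ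
  have hFQ : Finite ↥(F ⊔ Q) := finite_sup_of_finite F Q
  have hnot : ¬ F < F ⊔ Q := hmax (F ⊔ Q) hFQ
  have heq : F = F ⊔ Q := (eq_or_lt_of_le le_sup_left).resolve_right hnot
  exact heq ▸ le_sup_right

/-- **Eventually no finite submodule in `c^a V`.** `V` finitely generated over a Noetherian local ring, `c ∈ 𝔪`:
for some `a`, every finite submodule of `V` contained in `c^a V` is `⊥` (the largest finite submodule `F` meets
`c^a V` in an eventually constant chain whose limit lies in `⋂_a c^a V = 0`, Krull's intersection theorem).
[cite: Matsumura1987, Thm. 8.10] [cite: BourbakiAC5to7, Ch. VII §4 no. 4] -/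
theorem exists_forall_finite_le_range_lsmul_pow_eq_bot [IsNoetherianRing Λ] [IsLocalRing Λ]
    [Module.Finite Λ V] {c : Λ} (hc : c ∈ IsLocalRing.maximalIdeal Λ) :
    ∃ a : ℕ, ∀ Q : Submodule Λ V, Finite Q →
      Q ≤ LinearMap.range (LinearMap.lsmul Λ V (c ^ a)) → Q = ⊥ := by
  haveI : IsNoetherian Λ V := isNoetherian_of_isNoetherianRing_of_finite Λ V
  obtain ⟨F, hF, hFmax⟩ := exists_maximal_finite_submodule (Λ := Λ) (V := V)
  haveI : Finite F := hF
  -- the chain `a ↦ F ∩ c^a V`, read inside `F`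
  have hanti : ∀ a b : ℕ, a ≤ b → LinearMap.range (LinearMap.lsmul Λ V (c ^ b)) ≤
      LinearMap.range (LinearMap.lsmul Λ V (c ^ a)) := by
    intro a b hab x hx
    obtain ⟨y, rfl⟩ := (mem_range_lsmul_iff (c ^ b) x).mp hx
    refine (mem_range_lsmul_iff (c ^ a) _).mpr ⟨c ^ (b - a) • y, ?_⟩
    rw [smul_smul, ← pow_add, Nat.add_sub_cancel' hab]
  let f : ℕ →o (Submodule Λ F)ᵒᵈ :=
    ⟨fun a ↦ OrderDual.toDual ((LinearMap.range (LinearMap.lsmul Λ V (c ^ a))).comap F.subtype),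
      fun a b hab ↦ OrderDual.toDual_le_toDual.mpr (Submodule.comap_mono (hanti a b hab))⟩
  obtain ⟨a₀, ha₀⟩ := IsArtinian.monotone_stabilizes f
  have hle : ∀ a : ℕ, (LinearMap.range (LinearMap.lsmul Λ V (c ^ a₀))).comap F.subtype ≤
      (LinearMap.range (LinearMap.lsmul Λ V (c ^ a))).comap F.subtype := by
    intro a
    rcases le_total a a₀ with h | h
    · exact Submodule.comap_mono (hanti a a₀ h)
    · have h' : f a₀ = f a := ha₀ a h
      exact le_of_eq (OrderDual.toDual.injective h' :)
  -- Krull: the stable value is `⊥`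
  have hI : Ideal.span {c} ≠ (⊤ : Ideal Λ) :=
    ne_top_of_le_ne_top (IsLocalRing.maximalIdeal.isMaximal Λ).ne_top
      ((Ideal.span_singleton_le_iff_mem _).mpr hc)
  have hbot : (LinearMap.range (LinearMap.lsmul Λ V (c ^ a₀))).comap F.subtype = ⊥ := by
    rw [Submodule.eq_bot_iff]
    intro x hx
    have hx' : (x : V) ∈ (⨅ i : ℕ, (Ideal.span {c}) ^ i • ⊤ : Submodule Λ V) := by
      rw [Submodule.mem_iInf]
      intro a
      obtain ⟨y, hy⟩ := (mem_range_lsmul_iff (c ^ a) (x : V)).mp (hle a hx)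
      rw [← hy]
      exact Submodule.smul_mem_smul (Ideal.pow_mem_pow (Ideal.mem_span_singleton_self c) a)
        Submodule.mem_top
    rw [Ideal.iInf_pow_smul_eq_bot_of_isLocalRing _ hI, Submodule.mem_bot] at hx'
    exact Subtype.ext hx'
  refine ⟨a₀, fun Q hQ hQle ↦ ?_⟩
  rw [Submodule.eq_bot_iff]
  intro x hx
  have hxF : x ∈ F := hFmax Q hQ hx
  have hx0 : (⟨x, hxF⟩ : F) ∈ (LinearMap.range (LinearMap.lsmul Λ V (c ^ a₀))).comap F.subtype :=
    hQle hx
  rw [hbot, Submodule.mem_bot] at hx0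
  exact congr_arg Subtype.val hx0

/-- The same, phrased for the finite submodules of the MODULE `c^a V` (the `hfin` shape of
`PrintCf2.NoPseudoNullOfLine.noPseudoNull_of_X_regular_of_noFiniteSubmodule`). [cite: Matsumura1987, Thm. 8.10] -/
theorem exists_forall_finite_submodule_range_lsmul_pow_eq_bot [IsNoetherianRing Λ] [IsLocalRing Λ]
    [Module.Finite Λ V] {c : Λ} (hc : c ∈ IsLocalRing.maximalIdeal Λ) :
    ∃ a : ℕ, ∀ Q : Submodule Λ ↥(LinearMap.range (LinearMap.lsmul Λ V (c ^ a))), Finite Q → Q = ⊥ := by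
  obtain ⟨a, ha⟩ := exists_forall_finite_le_range_lsmul_pow_eq_bot (V := V) hc
  refine ⟨a, fun Q hQ ↦ ?_⟩
  have hfin : Finite ↥(Q.map (LinearMap.range (LinearMap.lsmul Λ V (c ^ a))).subtype) := by
    haveI : Finite Q := hQ
    exact Finite.of_equiv _ (Submodule.equivMapOfInjective _ (Submodule.injective_subtype _) Q).toEquiv
  have h0 := ha _ hfin (Submodule.map_subtype_le _ Q)
  have : Q.map (LinearMap.range (LinearMap.lsmul Λ V (c ^ a))).subtype =
      (⊥ : Submodule Λ ↥(LinearMap.range (LinearMap.lsmul Λ V (c ^ a)))).map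
        (LinearMap.range (LinearMap.lsmul Λ V (c ^ a))).subtype := by
    rw [h0, Submodule.map_bot]
  exact Submodule.map_injective_of_injective (Submodule.injective_subtype _) this

end MaxFinite

/-! ## §2–§3 No pseudo-null submodule in `r • Y` from regularity of a line element: the `w ∣ N` package -/

section RegularCore

open scoped Pointwise

variable {R : Type*} [CommRing R] {Y : Type*} [AddCommGroup Y] [Module R Y]

/-- **`(rY) ∩ tY = t(rY)` when `t` is a non-zero-divisor on `Y/rY`**: the natural map
`rY / t(rY) → Y / tY` (`QuotSMulTop.map t (rY).subtype`) is injective. [cite: BourbakiAC5to7, Ch. VII §4 no. 4] -/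
theorem quotSMulTop_map_subtype_injective (t r : R)
    (hreg : ∀ y : Y, t • y ∈ LinearMap.range (LinearMap.lsmul R Y r) →
      y ∈ LinearMap.range (LinearMap.lsmul R Y r)) :
    Function.Injective (QuotSMulTop.map t (LinearMap.range (LinearMap.lsmul R Y r)).subtype) := by
  rw [← LinearMap.ker_eq_bot, Submodule.eq_bot_iff]
  intro q hq
  obtain ⟨x, rfl⟩ := Submodule.Quotient.mk_surjective _ q
  rw [LinearMap.mem_ker, QuotSMulTop.map_apply_mk, Submodule.Quotient.mk_eq_zero,
    Submodule.mem_smul_pointwise_iff_exists] at hq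
  obtain ⟨v, -, hv⟩ := hq
  have hv' : t • v ∈ LinearMap.range (LinearMap.lsmul R Y r) := by
    rw [hv]; exact x.2
  rw [Submodule.Quotient.mk_eq_zero, Submodule.mem_smul_pointwise_iff_exists]
  exact ⟨⟨v, hreg v hv'⟩, Submodule.mem_top, Subtype.ext (by simpa using hv)⟩

/-- If `t` is a non-zero-divisor on `Y/rY` and no non-zero finite submodule of `Y/tY` lies in `r • (Y/tY)`, then
`rY / t(rY)` has no non-zero finite submodule (it embeds into `r • (Y/tY)`). [cite: BourbakiAC5to7, Ch. VII §4 no. 4] -/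
theorem forall_finite_submodule_quotSMulTop_range_lsmul_eq_bot (t r : R)
    (hreg : ∀ y : Y, t • y ∈ LinearMap.range (LinearMap.lsmul R Y r) →
      y ∈ LinearMap.range (LinearMap.lsmul R Y r))
    (hfin : ∀ Q : Submodule R (QuotSMulTop t Y), Finite Q →
      Q ≤ LinearMap.range (LinearMap.lsmul R (QuotSMulTop t Y) r) → Q = ⊥) :
    ∀ Q : Submodule R (QuotSMulTop t ↥(LinearMap.range (LinearMap.lsmul R Y r))), Finite Q → Q = ⊥ := by
  intro Q hQ
  have hι := quotSMulTop_map_subtype_injective t r hreg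
  have h1 : Finite ↥(Q.map (QuotSMulTop.map t (LinearMap.range (LinearMap.lsmul R Y r)).subtype)) := by
    haveI : Finite Q := hQ
    exact Finite.of_equiv _ (Submodule.equivMapOfInjective _ hι Q).toEquiv
  have h2 : Q.map (QuotSMulTop.map t (LinearMap.range (LinearMap.lsmul R Y r)).subtype) ≤
      LinearMap.range (LinearMap.lsmul R (QuotSMulTop t Y) r) := by
    rintro _ ⟨q, -, rfl⟩
    obtain ⟨x, rfl⟩ := Submodule.Quotient.mk_surjective _ q
    obtain ⟨u, hu⟩ := (mem_range_lsmul_iff r (x : Y)).mp x.2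
    refine (mem_range_lsmul_iff r _).mpr ⟨Submodule.Quotient.mk u, ?_⟩
    rw [QuotSMulTop.map_apply_mk, ← Submodule.Quotient.mk_smul, hu, Submodule.coe_subtype]
  have h3 := hfin _ h1 h2
  have h4 : Q.map (QuotSMulTop.map t (LinearMap.range (LinearMap.lsmul R Y r)).subtype) =
      (⊥ : Submodule R _).map (QuotSMulTop.map t (LinearMap.range (LinearMap.lsmul R Y r)).subtype) := by
    rw [h3, Submodule.map_bot]
  exact Submodule.map_injective_of_injective hι h4

end RegularCore

section TwoVar

variable (p : ℕ) [Fact p.Prime]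


/-- `p ∈ 𝔪_B` for `B = ℤ_p⟦X⟧⟦T⟧` (`IwasawaAlgebra₂ p`): its constant coefficient `p ∈ ℤ_p` is not a unit.
[folklore] [cite: Washington1997, §13.2] -/
theorem natCast_mem_maximalIdeal₂ :
    ((p : ℕ) : IwasawaAlgebra₂ p) ∈ IsLocalRing.maximalIdeal (IwasawaAlgebra₂ p) := by
  rw [IsLocalRing.mem_maximalIdeal, mem_nonunits_iff, PowerSeries.isUnit_iff_constantCoeff, map_natCast,
    PowerSeries.isUnit_iff_constantCoeff, map_natCast]
  exact PadicInt.p_nonunit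

/-- **The `w ∣ N` package, dual side.** `Y` a finitely generated `B = ℤ_p⟦X⟧⟦T⟧`-module on which `T` is a
non-zero-divisor, and a non-zero-divisor on every `Y / p^a Y`: then for some `a`, the submodule `p^a Y` has NO
non-zero pseudo-null `B`-submodule. (§1 on `Y/TY` gives `a` with no finite submodule of `Y/TY` inside
`p^a (Y/TY)`; §2 transfers it to `p^a Y / T p^a Y`; then S3n ⟸ (REG) ∧ (NF),
`PrintCf2.NoPseudoNullOfLine.noPseudoNull_of_X_regular_of_noFiniteSubmodule`.) In the cell's model `Y = (𝐃^{I_w})^∨`,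
`Y/TY = (A^{I_w})^∨` and the maximal finite submodule of the latter is the dual of the non-divisible part of `A^{I_w}`.
[cite: BourbakiAC5to7, Ch. VII §4 no. 4] [cite: Greenberg2016Selmer, §4.2 p. 19 L25–31] [cite: Matsumura1987, Thm. 8.10, Thm. 23.2 (ii)] -/
theorem exists_hasNoPseudoNullSubmodule_range_lsmul_pow (Y : Type) [AddCommGroup Y]
    [Module (IwasawaAlgebra₂ p) Y] [Module.Finite (IwasawaAlgebra₂ p) Y]
    (hT : ∀ y : Y, (PowerSeries.X : IwasawaAlgebra₂ p) • y = 0 → y = 0)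
    (hTa : ∀ (a : ℕ) (y : Y), (PowerSeries.X : IwasawaAlgebra₂ p) • y ∈
        LinearMap.range (LinearMap.lsmul (IwasawaAlgebra₂ p) Y (((p : ℕ) : IwasawaAlgebra₂ p) ^ a)) →
      y ∈ LinearMap.range (LinearMap.lsmul (IwasawaAlgebra₂ p) Y (((p : ℕ) : IwasawaAlgebra₂ p) ^ a))) :
    ∃ a : ℕ, HasNoPseudoNullSubmodule (IwasawaAlgebra₂ p)
      ↥(LinearMap.range (LinearMap.lsmul (IwasawaAlgebra₂ p) Y (((p : ℕ) : IwasawaAlgebra₂ p) ^ a))) := by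
  obtain ⟨a, ha⟩ := exists_forall_finite_le_range_lsmul_pow_eq_bot
    (V := QuotSMulTop (PowerSeries.X : IwasawaAlgebra₂ p) Y) (natCast_mem_maximalIdeal₂ p)
  refine ⟨a, ?_⟩
  haveI : IsNoetherian (IwasawaAlgebra₂ p) Y := isNoetherian_of_isNoetherianRing_of_finite _ _
  intro N hN
  refine PrintCf2.NoPseudoNullOfLine.noPseudoNull_of_X_regular_of_noFiniteSubmodule p
    (↥(LinearMap.range (LinearMap.lsmul (IwasawaAlgebra₂ p) Y (((p : ℕ) : IwasawaAlgebra₂ p) ^ a))))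
    (fun x hx ↦ Subtype.ext (hT x (by simpa using congr_arg Subtype.val hx)))
    (forall_finite_submodule_quotSMulTop_range_lsmul_eq_bot (PowerSeries.X : IwasawaAlgebra₂ p)
      (((p : ℕ) : IwasawaAlgebra₂ p) ^ a) (hTa a) ha) N hN

/-- **The `w ∣ N` package, local-condition side**: for a local condition `N ≤ H` (read `L(K_w, 𝐃) ≤ H¹(K_w, 𝐃)`)
whose character module embeds `B`-linearly in such a `Y` (read `(𝐃^{I_w})^∨`), SOME `p^a • N` is an almost
divisible `B`-module — the core local condition of route G′ at `w ∣ N`, with `p^a N ≤ core ≤ N`.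
[cite: Greenberg2016Selmer, §2.5 p. 8 L35–37, Remark 3.1.2, §4.2 p. 19 L25–31] [cite: Greenberg2006, Prop. 2.4] -/
theorem exists_isAlmostDivisible_map_lsmul_pow {H : Type} [AddCommGroup H] [Module (IwasawaAlgebra₂ p) H]
    (N : Submodule (IwasawaAlgebra₂ p) H) {Y : Type} [AddCommGroup Y] [Module (IwasawaAlgebra₂ p) Y]
    [Module.Finite (IwasawaAlgebra₂ p) Y] (g : CharacterModule ↥N →ₗ[IwasawaAlgebra₂ p] Y)
    (hg : Function.Injective g)
    (hT : ∀ y : Y, (PowerSeries.X : IwasawaAlgebra₂ p) • y = 0 → y = 0)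
    (hTa : ∀ (a : ℕ) (y : Y), (PowerSeries.X : IwasawaAlgebra₂ p) • y ∈
        LinearMap.range (LinearMap.lsmul (IwasawaAlgebra₂ p) Y (((p : ℕ) : IwasawaAlgebra₂ p) ^ a)) →
      y ∈ LinearMap.range (LinearMap.lsmul (IwasawaAlgebra₂ p) Y (((p : ℕ) : IwasawaAlgebra₂ p) ^ a))) :
    ∃ a : ℕ, IsAlmostDivisible (IwasawaAlgebra₂ p)
      ↥(N.map (LinearMap.lsmul (IwasawaAlgebra₂ p) H (((p : ℕ) : IwasawaAlgebra₂ p) ^ a))) := by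
  obtain ⟨a, ha⟩ := exists_hasNoPseudoNullSubmodule_range_lsmul_pow p Y hT hTa
  exact ⟨a, isAlmostDivisible_map_lsmul_of_hasNoPseudoNullSubmodule N _
    (hasNoPseudoNullSubmodule_range_lsmul_of_injective g hg _ ha)⟩

/-- **The `w ∣ N` package, discrete side.** For a `B`-module `M` (read `𝐃^{I_w}`) with finitely generated character
module, `T`-DIVISIBLE and with `T`-divisible `p^a`-torsion for every `a` (the two divisibilities of the big
representation), some `p^a M̂` has no non-zero pseudo-null `B`-submodule. [cite: Greenberg2016Selmer, §4.2 p. 19 L25–31]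
[cite: Greenberg2006, Prop. 2.4, p. 350 L25–36] [cite: BourbakiAC5to7, Ch. VII §4 no. 4] -/
theorem exists_hasNoPseudoNullSubmodule_range_lsmul_pow_characterModule (M : Type) [AddCommGroup M]
    [Module (IwasawaAlgebra₂ p) M] [Module.Finite (IwasawaAlgebra₂ p) (CharacterModule M)]
    (hdiv : ∀ m : M, ∃ m' : M, (PowerSeries.X : IwasawaAlgebra₂ p) • m' = m)
    (hdiva : ∀ (a : ℕ) (m : M), (((p : ℕ) : IwasawaAlgebra₂ p) ^ a) • m = 0 →
      ∃ m' : M, (((p : ℕ) : IwasawaAlgebra₂ p) ^ a) • m' = 0 ∧ (PowerSeries.X : IwasawaAlgebra₂ p) • m' = m) :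
    ∃ a : ℕ, HasNoPseudoNullSubmodule (IwasawaAlgebra₂ p)
      ↥(LinearMap.range (LinearMap.lsmul (IwasawaAlgebra₂ p) (CharacterModule M)
        (((p : ℕ) : IwasawaAlgebra₂ p) ^ a))) :=
  exists_hasNoPseudoNullSubmodule_range_lsmul_pow p (CharacterModule M)
    (smul_characterModule_eq_zero_imp_of_divisible hdiv)
    (fun a ↦ mem_range_lsmul_of_smul_mem_of_torsion_divisible (hdiva a))

/-- **The `w ∣ N` package, local-condition side, discrete hypotheses**: if the local condition `N ≤ H` (read
`L(K_w, 𝐃) ≤ H¹(K_w, 𝐃)`) is a `B`-linear QUOTIENT of such an `M` (read `𝐃^{I_w} ↠ 𝐃^{I_w}/(Frob_w − 1) ≅ H¹_ur ≅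
L(K_w, 𝐃)`), then some `p^a • N` is an almost divisible `B`-module, `p^a • N ≤ N`: the core local condition of route
G′ at `w ∣ N`. [cite: Greenberg2016Selmer, §2.5 p. 8 L35–37, Remark 3.1.2, §4.2 p. 19 L25–31] [cite: Greenberg2006, Prop. 2.4] -/
theorem exists_isAlmostDivisible_map_lsmul_pow_of_surjective {H : Type} [AddCommGroup H]
    [Module (IwasawaAlgebra₂ p) H] (N : Submodule (IwasawaAlgebra₂ p) H) {M : Type} [AddCommGroup M]
    [Module (IwasawaAlgebra₂ p) M] [Module.Finite (IwasawaAlgebra₂ p) (CharacterModule M)]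
    (π : M →ₗ[IwasawaAlgebra₂ p] ↥N) (hπ : Function.Surjective π)
    (hdiv : ∀ m : M, ∃ m' : M, (PowerSeries.X : IwasawaAlgebra₂ p) • m' = m)
    (hdiva : ∀ (a : ℕ) (m : M), (((p : ℕ) : IwasawaAlgebra₂ p) ^ a) • m = 0 →
      ∃ m' : M, (((p : ℕ) : IwasawaAlgebra₂ p) ^ a) • m' = 0 ∧ (PowerSeries.X : IwasawaAlgebra₂ p) • m' = m) :
    ∃ a : ℕ, IsAlmostDivisible (IwasawaAlgebra₂ p)
      ↥(N.map (LinearMap.lsmul (IwasawaAlgebra₂ p) H (((p : ℕ) : IwasawaAlgebra₂ p) ^ a))) :=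
  exists_isAlmostDivisible_map_lsmul_pow p N (CharacterModule.dual π)
    (CharacterModule.dual_injective_of_surjective π hπ)
    (smul_characterModule_eq_zero_imp_of_divisible hdiv)
    (fun a ↦ mem_range_lsmul_of_smul_mem_of_torsion_divisible (hdiva a))

end TwoVar

end Summit.BirchSwinnertonDyer.BirchSwinnertonDyer.Theorems.TelescopeK2PurityCoreAtBadPrimes
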